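import Literature.AlgebraicGeometry.Frobenioids.Composites
import HarnessLib

/-!
# Frobenioids I, Theorem 5.1 (iii), preliminaries: Frobenius-trivial objects and isometries in a
# Frobenioid of isotropic type (abc-iut cell, layer L1, node D-η-3)

Mochizuki, *The geometry of Frobenioids I: the general theory*, Kyushu J. Math. **62** (2008)
293–400, §5, Theorem 5.1 (iii) and its proof, kurims text pp. 97, 99
[cite: MochizukiFrdI2008, Thm. 5.1 (iii) p.97]:

> "(iii) The subcategory `C^Fr-tr ⊆ C` determined by the Frobenius-trivial objects and isometric
> morphisms is a Frobenioid of isotropic, group-like, base-trivial, and `Aut`-ample type."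
> Proof (p. 99): "… [in light of the fact that `A′` is Frobenius-trivial, hence admits base-identity
> endomorphisms of Frobenius type of arbitrary prescribed Frobenius degree] … In light of these
> observations, it follows immediately that `C^Fr-tr` satisfies the conditions of Definition 1.3".

The "immediate" verification rests on a handful of facts about a Frobenioid `C → F_Φ` *of
isotropic type* which this file isolates: every arrow is co-angular (Prop. 1.4 (i)), so that
"Frobenius type" = isometric base-isomorphism and "pull-back morphism" = linear isometry
(Prop. 1.4 (ii)); Frobenius-triviality is invariant under isomorphism, passes to the codomain of a
morphism of Frobenius type (Def. 1.3 (ii)) and to the domain of a pull-back morphism (lifting the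
Frobenius endomorphisms, Def. 1.2 (ii)); and an isometry factors as (Frobenius type) ∘ (pull-back)
(Def. 1.3 (iv)(a) with the middle pre-step isometric, hence invertible). No statement of the
paper is strengthened.
-/

namespace Literature.AlgebraicGeometry.Frobenioids

namespace PreFrobenioid

open CategoryTheory Opposite

universe w v v' u u'

variable {D : Type u} [Category.{v} D] {Φ : Dᵒᵖ ⥤ CommMonCat.{w}}
  {C : Type u'} [Category.{v'} C] (F : C ⥤ ElemFrobenioid Φ)

/-! ### Frobenioids of isotropic type -/

/-- In a pre-Frobenioid of isotropic type every arrow is co-angular (Prop. 1.4 (i)).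
[cite: MochizukiFrdI2008, Prop. 1.4 (i) p.26] -/
theorem isCoAngular_of_isOfIsotropicType (hiso : IsOfIsotropicType F) {A B : C} (φ : A ⟶ B) :
    IsCoAngular F φ :=
  isCoAngular_of_isIsotropic_codomains F φ fun X _ => hiso X

/-- Isotropic type: Frobenius type = isometric base-isomorphism (Prop. 1.4 (i)).
[cite: MochizukiFrdI2008, Prop. 1.4 (i) p.26] -/
theorem isFrobeniusType_iff_of_isOfIsotropicType (hiso : IsOfIsotropicType F) {A B : C} (φ : A ⟶ B) :
    IsFrobeniusType F φ ↔ IsIsometry F φ ∧ IsBaseIso F φ :=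
  isFrobeniusType_iff_of_isIsotropic_codomains F φ fun X _ => hiso X

/-- Isotropic type: pull-back morphism = linear isometry (Prop. 1.4 (ii) with (i)).
[cite: MochizukiFrdI2008, Prop. 1.4 (ii) p.26] -/
theorem isPullbackMorphism_iff_of_isOfIsotropicType (hF : IsFrobenioid F) (hiso : IsOfIsotropicType F)
    {A B : C} (φ : A ⟶ B) : IsPullbackMorphism F φ ↔ IsIsometry F φ ∧ IsLinear F φ := by
  rw [isPullbackMorphism_iff_isLBInvertible_isLinear F hF]
  exact ⟨fun h => ⟨h.1.2, h.2⟩, fun h => ⟨⟨isCoAngular_of_isOfIsotropicType F hiso φ, h.1⟩, h.2⟩⟩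

/-! ### Frobenius-trivial objects -/

/-- Conjugation `End(A) → End(B)` along an isomorphism `e : A ⥲ B`, as a homomorphism of monoids.
[cite: MochizukiFrdI2008, Def. 1.2 (iv) p.24] -/
def endConj {A B : C} (e : A ≅ B) : End A →* End B where
  toFun a := e.inv ≫ (show A ⟶ A from a) ≫ e.hom
  map_one' := by
    show e.inv ≫ 𝟙 A ≫ e.hom = 𝟙 B
    rw [Category.id_comp, e.inv_hom_id]
  map_mul' a b := by
    show e.inv ≫ ((show A ⟶ A from b) ≫ (show A ⟶ A from a)) ≫ e.hom =
      (e.inv ≫ (show A ⟶ A from b) ≫ e.hom) ≫ (e.inv ≫ (show A ⟶ A from a) ≫ e.hom)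
    simp only [Category.assoc, e.hom_inv_id_assoc]

/-- Frobenius-triviality is invariant under isomorphism (conjugate `ζ_A` by `A ⥲ B`).
[cite: MochizukiFrdI2008, Def. 1.2 (iv) p.24] -/
theorem IsFrobeniusTrivial.of_iso (hF : IsFrobenioid F) {A B : C} (e : A ≅ B)
    (hA : IsFrobeniusTrivial F A) : IsFrobeniusTrivial F B := by
  obtain ⟨ζ, hζ⟩ := hA
  refine ⟨(endConj e).comp ζ, fun n => ?_⟩
  obtain ⟨hn, hb, hft⟩ := hζ n
  have hb' : Base F (show A ⟶ A from ζ n) = 𝟙 _ := hb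
  refine ⟨?_, ?_, ?_⟩
  · show degFr F (e.inv ≫ (show A ⟶ A from ζ n) ≫ e.hom) = n
    rw [degFr_comp, degFr_comp, hn, show degFr F e.inv = 1 from isLinear_of_isIso F e.inv,
      show degFr F e.hom = 1 from isLinear_of_isIso F e.hom, one_mul, mul_one]
  · show Base F (e.inv ≫ (show A ⟶ A from ζ n) ≫ e.hom) = 𝟙 _
    rw [base_comp, base_comp, hb', Category.id_comp, ← base_comp, e.inv_hom_id, base_id]
  · exact IsFrobeniusType.comp F hF (isFrobeniusType_of_isIso F hF.isPreFrobenioid e.inv)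
      (IsFrobeniusType.comp F hF hft (isFrobeniusType_of_isIso F hF.isPreFrobenioid e.hom))

/-- A morphism of Frobenius type out of a Frobenius-trivial object is, up to an isomorphism of the
codomain over the same base arrow, the Frobenius endomorphism of the same degree (Def. 1.3 (ii)).
[cite: MochizukiFrdI2008, Thm. 5.1 (iii) p.99] -/
theorem exists_iso_of_isFrobeniusType (hF : IsFrobenioid F) {A B : C} (hA : IsFrobeniusTrivial F A)
    (φ : A ⟶ B) (hφ : IsFrobeniusType F φ) : ∃ β : A ≅ B, Base F β.hom = Base F φ := by
  obtain ⟨ζ, hζ⟩ := hA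
  obtain ⟨hn, hb, hft⟩ := hζ (degFr F φ)
  have hb' : Base F (show A ⟶ A from ζ (degFr F φ)) = 𝟙 _ := hb
  obtain ⟨β, hβ⟩ := hF.ii_unique (show A ⟶ A from ζ (degFr F φ)) φ hft hφ hn
  refine ⟨β, ?_⟩
  have h := congrArg (Base F) hβ
  rw [base_comp, hb', Category.id_comp] at h
  exact h

/-- The codomain of a morphism of Frobenius type out of a Frobenius-trivial object is
Frobenius-trivial. [cite: MochizukiFrdI2008, Thm. 5.1 (iii) p.99] -/
theorem IsFrobeniusTrivial.codomain (hF : IsFrobenioid F) {A B : C} (hA : IsFrobeniusTrivial F A)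
    (φ : A ⟶ B) (hφ : IsFrobeniusType F φ) : IsFrobeniusTrivial F B := by
  obtain ⟨β, _⟩ := exists_iso_of_isFrobeniusType F hF hA φ hφ
  exact hA.of_iso F hF β

/-- The domain of a pull-back morphism into a Frobenius-trivial object is Frobenius-trivial (isotropic
type): the Frobenius endomorphisms lift uniquely along the pull-back morphism (Def. 1.2 (ii)).
[cite: MochizukiFrdI2008, Thm. 5.1 (iii) p.99] -/
theorem IsFrobeniusTrivial.of_isPullbackMorphism (hF : IsFrobenioid F) (hiso : IsOfIsotropicType F)
    {X A : C} (ψ : X ⟶ A) (hψ : IsPullbackMorphism F ψ) (hA : IsFrobeniusTrivial F A) :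
    IsFrobeniusTrivial F X := by
  obtain ⟨ζ, hζ⟩ := hA
  obtain ⟨⟨_, hψiso⟩, hψlin⟩ := hF.iv_b ψ hψ
  have hψiso' : Div F ψ = 1 := hψiso
  have hψlin' : degFr F ψ = 1 := hψlin
  have key : ∀ n : ℕ+, ∃! z : X ⟶ X, z ≫ ψ = ψ ≫ (show A ⟶ A from ζ n) ∧ Base F z = 𝟙 _ := by
    intro n
    have hb : Base F (show A ⟶ A from ζ n) = 𝟙 _ := (hζ n).2.1
    have hcompat : Base F (ψ ≫ (show A ⟶ A from ζ n)) = 𝟙 _ ≫ Base F ψ := by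
      rw [base_comp, hb, Category.comp_id, Category.id_comp]
    obtain ⟨z, hz⟩ := (hψ X).2 ⟨(ψ ≫ (show A ⟶ A from ζ n), 𝟙 _), hcompat⟩
    refine ⟨z, ⟨congrArg (fun p : PullbackHomData F ψ X => p.1.1) hz,
      congrArg (fun p : PullbackHomData F ψ X => p.1.2) hz⟩, fun z' hz' => ?_⟩
    exact (hψ X).1 ((Subtype.ext (Prod.ext hz'.1 hz'.2)).trans hz.symm)
  choose z hz huniq using key
  have h1 : (show A ⟶ A from ζ 1) = 𝟙 A := by
    rw [map_one]
    rfl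
  let ζ' : ℕ+ →* End X :=
    { toFun := z
      map_one' := (huniq 1 (𝟙 X) ⟨by rw [h1, Category.id_comp, Category.comp_id], base_id F X⟩).symm
      map_mul' := fun m n => by
        refine (huniq (m * n) (z n ≫ z m) ⟨?_, ?_⟩).symm
        · have e1 := (hz m).1
          have e2 := (hz n).1
          change (z n ≫ z m) ≫ ψ = ψ ≫ End.asHom (ζ (m * n))
          rw [map_mul, End.mul_def]
          change (z n ≫ z m) ≫ ψ = ψ ≫ (End.asHom (ζ n) ≫ End.asHom (ζ m))
          rw [Category.assoc, e1, ← Category.assoc, e2, Category.assoc]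
        · show Base F (z n ≫ z m) = 𝟙 _
          rw [base_comp, (hz n).2, (hz m).2, Category.comp_id] }
  refine ⟨ζ', fun n => ?_⟩
  have hdeg : degFr F (z n) = n := by
    have h := congrArg (degFr F) (hz n).1
    rw [degFr_comp, degFr_comp, hψlin', mul_one, one_mul, (hζ n).1] at h
    exact h
  have hdiv : IsIsometry F (z n) := by
    have h := congrArg (Div F) (hz n).1
    rw [div_comp, div_comp, hψiso', map_one, one_mul, hψlin', PNat.one_coe, pow_one,
      show Div F (show A ⟶ A from ζ n) = 1 from (hζ n).2.2.1.2, map_one, one_pow, one_mul] at h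
    exact h
  refine ⟨hdeg, (hz n).2, ⟨isCoAngular_of_isOfIsotropicType F hiso _, hdiv⟩, ?_⟩
  show IsIso (Base F (z n))
  rw [(hz n).2]
  infer_instance

/-! ### Isometries factor as (Frobenius type) ∘ (pull-back) -/

/-- In a Frobenioid of isotropic type an isometry `φ` factors as `φ = α ∘ γ` with `γ` of Frobenius
type and `α` a pull-back morphism (Def. 1.3 (iv)(a); the middle pre-step is isometric, hence an
isomorphism). [cite: MochizukiFrdI2008, Thm. 5.1 (iii) p.99] -/
theorem exists_frobeniusType_pullback_of_isIsometry (hF : IsFrobenioid F) (hiso : IsOfIsotropicType F)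
    {A B : C} (φ : A ⟶ B) (hφ : IsIsometry F φ) :
    ∃ (Y : C) (γ : A ⟶ Y) (α : Y ⟶ B), γ ≫ α = φ ∧ IsFrobeniusType F γ ∧ IsPullbackMorphism F α := by
  obtain ⟨X, Y, γ, β, α, hfac, hγ, hβ, hα⟩ := hF.iv_a_exists φ
  obtain ⟨⟨_, hαiso⟩, hαlin⟩ := hF.iv_b α hα
  have hβiso : IsIsometry F β := by
    have h : Div F (γ ≫ β ≫ α) = 1 := by
      rw [hfac]
      exact hφ
    rw [div_comp, div_comp, show Div F α = 1 from hαiso, map_one, one_mul,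
      show Div F γ = 1 from hγ.1.2, one_pow, mul_one, show degFr F α = 1 from hαlin, PNat.one_coe,
      pow_one] at h
    exact (hF.isPreFrobenioid.isMonoidOn.isCharInjective (Base F γ)).1 (h.trans (map_one _).symm)
  haveI : IsIso β := hiso X β hβiso hβ
  exact ⟨Y, γ ≫ β, α, by rw [Category.assoc, hfac],
    IsFrobeniusType.comp F hF hγ (isFrobeniusType_of_isIso F hF.isPreFrobenioid β), hα⟩

/-- With `A` Frobenius-trivial, the middle object of such a factorisation is Frobenius-trivial.
[cite: MochizukiFrdI2008, Thm. 5.1 (iii) p.99] -/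
theorem exists_frobeniusType_pullback_of_isIsometry' (hF : IsFrobenioid F) (hiso : IsOfIsotropicType F)
    {A B : C} (hA : IsFrobeniusTrivial F A) (φ : A ⟶ B) (hφ : IsIsometry F φ) :
    ∃ (Y : C) (γ : A ⟶ Y) (α : Y ⟶ B), γ ≫ α = φ ∧ IsFrobeniusType F γ ∧ IsPullbackMorphism F α ∧
      IsFrobeniusTrivial F Y := by
  obtain ⟨Y, γ, α, h, hγ, hα⟩ := exists_frobeniusType_pullback_of_isIsometry F hF hiso φ hφ
  exact ⟨Y, γ, α, h, hγ, hα, hA.codomain F hF γ hγ⟩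

end PreFrobenioid

end Literature.AlgebraicGeometry.Frobenioids
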